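import Mathlib
import HarnessLib
import Summits.HubbardSuperconductivity.HubbardSuperconductivity.Theorems.KLProgrammeKLRegimeTwoVolumeTowerDataDefs
import Summits.HubbardSuperconductivity.HubbardSuperconductivity.Theorems.KLProgrammeKLRegimeTwoVolumeTowerTruncKit

/-!
# Route `KLProgramme` — crux K3, VL child `KLRegimeVolumeLimitV17F2` (stmt-HubbardSuperconductivity-20440), blueprint v5 M5: THE SOURCE-TRUNCATED DATA
# PACKAGE (definitions; located «(VL)-SRC-HIGH»; seat hubbard-kl-k3c4-p1 g14; `--supports` 20440; definition lane)

`…TowerDataDefs.TowerData β U μ` asks (field `hdata`, bundle `…TowerSpineDefs.TowerVolumeData.profile`) for E1's weighted even profile of the FULL doubled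
read-out `klTowerD V M β U μ K j` — every number of source legs.  The producers of record cover at most two source legs (E1's alive read-out, token #24),
and the END reads `srcTrunc 3 (klTowerD … J)` only; by the exactness of source grading (`…TowerTruncKit`) the induction runs on the source-truncated states.
This file NAMES the corresponding data:

* `klKeyedDefectT L b M β U μ Kc Kf j k p w` — the keyed two-volume defect of the SOURCE-TRUNCATED states `srcTrunc 3 (klTowerState …)`;
  `klKeyedDefectT_nonneg`, **`klKeyedDefectT_le`** (`≤ klKeyedDefect`, by `…TowerTruncKit.sum_filter_norm_keyed_kernel_srcTrunc_le`);
* **`TowerVolumeDataT`** — `TowerVolumeData` with the profile field on `srcTrunc 3 (klTowerD V … K j)` (what E1's alive read-out ⊕ token #24 produce);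
  `TowerVolumeData.trunc` (the untruncated bundle implies it);
* **`TowerDataT β U μ`** — `TowerData β U μ` with `TowerVolumeDataT` in (H5) (everything else byte-identical: constants, (H1)–(H4), `TowerCrossData`, the base
  (H6) on the SOURCE-TRUNCATED step-`0` states — dominated by the untruncated base of the W4 chain, `klKeyedDefectT_le`); `TowerData.trunc`,
  `nonempty_towerDataT_of_towerData`.

The truncated spine/end/closer (`…TowerTrunc*`, successors of p601101/p601937/p602349/p602969) conclude the registered stub text from `Nonempty (TowerDataT β U μ)`.
Definitions (with bodies) and their trivial unfoldings/monotonicity only; nothing about the model is asserted.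
-/

noncomputable section

namespace Summit.HubbardSuperconductivity.HubbardSuperconductivity.Theorems.TwoVolumeSource

set_option linter.dupNamespace false -- summit = problem name (single-conjunct summit), D-0017

open Finset Filter Topology Literature.MathematicalPhysics.QuantumLattice GrassmannAlgebra Literature.Probability.LatticeModels
  Literature.Probability.LatticeModels.BattleFederbush
open Summit.HubbardSuperconductivity.HubbardSuperconductivity.Theorems.TwoPointAssembly
open Summit.HubbardSuperconductivity.HubbardSuperconductivity.Theorems.KLRegimeSplit
open Summit.HubbardSuperconductivity.HubbardSuperconductivity.Theorems.KLProgrammeLegKernels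
open Summit.HubbardSuperconductivity.HubbardSuperconductivity.Theorems.EngineV8
open Summit.HubbardSuperconductivity.HubbardSuperconductivity.Theorems.TwoVolumeDefect

/-! ## §1 The keyed defect of the source-truncated states -/

section Defect

variable (L b M : ℕ) [NeZero L] [NeZero (b * L)]

/-- **The keyed two-volume defect of the SOURCE-TRUNCATED tower states** at step `j`, raw degree `k`, pin slot `p`, fine pin `w` (same key as
`klKeyedDefect`, states replaced by `srcTrunc 3 (klTowerState …)`). [cite: BenfattoGiulianiMastropietro2006, §2.9 (4.3)-(4.6)] -/
def klKeyedDefectT (β U μ : ℝ) (Kc Kf : TrigPolyC4v) (j k : ℕ) (p : Fin k) (w : SrcLabel (b * L) M (j - 1)) : ℝ :=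
  ∑ X ∈ univ.filter (fun X : Fin k → SrcLabel (b * L) M (j - 1) => X p = w),
    ‖kernel ℂ (srcTrunc ℂ (fun q : SrcLabel (b * L) M (j - 1) => q.2 = 1) 3 (klTowerState (b * L) M β U μ Kf j)) k X -
      (if ∀ i, (klBlockEquivD L b M (j - 1) (X i)).1 = (klBlockEquivD L b M (j - 1) (X p)).1 then
        kernel ℂ (srcTrunc ℂ (fun q : SrcLabel L M (j - 1) => q.2 = 1) 3 (klTowerState L M β U μ Kc j)) k
          (fun i => (klBlockEquivD L b M (j - 1) (X i)).2) else 0)‖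

variable {L b M}

/-- Unfolding `klKeyedDefectT`. [folklore] -/
theorem klKeyedDefectT_eq (β U μ : ℝ) (Kc Kf : TrigPolyC4v) (j k : ℕ) (p : Fin k) (w : SrcLabel (b * L) M (j - 1)) :
    klKeyedDefectT L b M β U μ Kc Kf j k p w =
      ∑ X ∈ univ.filter (fun X : Fin k → SrcLabel (b * L) M (j - 1) => X p = w),
        ‖kernel ℂ (srcTrunc ℂ (fun q : SrcLabel (b * L) M (j - 1) => q.2 = 1) 3 (klTowerState (b * L) M β U μ Kf j)) k X -
          (if ∀ i, (klBlockEquivD L b M (j - 1) (X i)).1 = (klBlockEquivD L b M (j - 1) (X p)).1 then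
            kernel ℂ (srcTrunc ℂ (fun q : SrcLabel L M (j - 1) => q.2 = 1) 3 (klTowerState L M β U μ Kc j)) k
              (fun i => (klBlockEquivD L b M (j - 1) (X i)).2) else 0)‖ := rfl

/-- The truncated keyed defect is nonnegative. [folklore] -/
theorem klKeyedDefectT_nonneg (β U μ : ℝ) (Kc Kf : TrigPolyC4v) (j k : ℕ) (p : Fin k) (w : SrcLabel (b * L) M (j - 1)) :
    0 ≤ klKeyedDefectT L b M β U μ Kc Kf j k p w :=
  sum_nonneg fun _ _ => norm_nonneg _

/-- **The truncated keyed defect is dominated by the untruncated one** (the canonical doubled block structure keeps the copy). [folklore] -/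
theorem klKeyedDefectT_le (β U μ : ℝ) (Kc Kf : TrigPolyC4v) (j k : ℕ) (p : Fin k) (w : SrcLabel (b * L) M (j - 1)) :
    klKeyedDefectT L b M β U μ Kc Kf j k p w ≤ klKeyedDefect L b M β U μ Kc Kf j k p w := by
  rw [klKeyedDefectT_eq, klKeyedDefect_eq]
  exact sum_filter_norm_keyed_kernel_srcTrunc_le (klBlockEquivD L b M (j - 1))
    (fun y => by obtain ⟨x, s⟩ := y; rw [klBlockEquivD_apply]) _ _ 3 k p w

end Defect

/-! ## §2 The source-truncated one-volume bundle -/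

/-- **`TowerVolumeDataT V M β U μ K J ε Λ κ aW sW NV`** — `TowerVolumeData` with E1's even weighted profiles asked of the SOURCE-TRUNCATED read-outs
`srcTrunc 3 (klTowerD V … K j)` only (strings with at most two source legs: E1's alive read-out ⊕ token #24). -/
structure TowerVolumeDataT (V M : ℕ) [NeZero V] (β U μ : ℝ) (K : TrigPolyC4v) (J : ℕ) (ε : ℝ) (Λ κ aW sW : ℕ → ℝ) (NV : ℕ → ℕ → ℝ) : Prop where
  /-- partition functions of the integrated scales -/
  Z : ∀ k, k + 1 ≤ J → hubbardEffPartitionFnCT V M β U μ 0 K (klScale klE0 (k + 1)) ≠ 0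
  /-- parity of the read-outs -/
  parity : ∀ j, j ≤ J → klTowerD V M β U μ K j ∈ evenOdd ℂ 0 ∧ constPart ℂ (klTowerD V M β U μ K j) = 0
  /-- step-covariance bundles -/
  cov : ∀ j, j < J → ScaleCovData (klStepCov V M β μ K j) (Λ j) (κ j) (aW j / ε) (sW j)
  /-- E1's even weighted profiles (normalised) of the SOURCE-TRUNCATED read-outs -/
  profile : ∀ j, j ≤ J → WtProfileEven (srcTrunc ℂ (fun q : SrcLabel V M j => q.2 = 1) 3 (klTowerD V M β U μ K j)) (Λ j) (fun m => ε * NV j m)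

/-- The untruncated bundle implies the truncated one. [folklore] -/
theorem TowerVolumeData.trunc {V M : ℕ} [NeZero V] {β U μ : ℝ} {K : TrigPolyC4v} {J : ℕ} {ε : ℝ} {Λ κ aW sW : ℕ → ℝ} {NV : ℕ → ℕ → ℝ}
    (h : TowerVolumeData V M β U μ K J ε Λ κ aW sW NV) : TowerVolumeDataT V M β U μ K J ε Λ κ aW sW NV where
  Z := h.Z
  parity := h.parity
  cov := h.cov
  profile j hj := (h.profile j hj).srcTrunc 3

/-! ## §3 The source-truncated data package -/

/-- **`TowerDataT β U μ`** — `TowerData β U μ` with the one-volume bundles source-truncated (see the module docstring). -/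
structure TowerDataT (β U μ : ℝ) where
  /-- Matsubara-cutoff threshold of an admissible instance `(L, b, M)`: `Mth L b ≤ M` -/
  Mth : ℕ → ℕ → ℕ
  /-- the depth schedule `r_L → ∞` with `2·(2(J+1)·r_L + r_L) < L`, `J = nScales β` -/
  r : ℕ → ℕ
  hr : Tendsto r atTop atTop
  hRd : ∀ L, 0 < L → 2 * (2 * (nScales β + 1) * r L + r L) < L
  /-- volume-free constants per scale -/
  Λ : ℕ → ℝ
  κ : ℕ → ℝ
  aW : ℕ → ℝ
  sW : ℕ → ℝ
  κ' : ℕ → ℝ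
  aW' : ℕ → ℝ
  sW' : ℕ → ℝ
  eW' : ℕ → ℝ
  ΛT : ℕ → ℝ
  cW : ℕ → ℝ
  κf : ℕ → ℝ
  cRb : ℕ → ℝ
  cCb : ℕ → ℝ
  δb : ℕ → ℝ
  ρ₀ : ℕ → ℝ
  ρf : ℕ → ℝ
  ρ₂ : ℕ → ℝ
  ρ' : ℕ → ℝ
  ρ₃ : ℕ → ℝ
  ν₀ : ℕ → ℝ
  ν₁ : ℕ → ℝ
  ν₂ : ℕ → ℝ
  ν₃ : ℕ → ℝ
  ν₄ : ℕ → ℝ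
  ν₅ : ℕ → ℝ
  νE : ℕ → ℝ
  ν₆ : ℕ → ℝ
  ν₇ : ℕ → ℝ
  ν₈ : ℕ → ℝ
  /-- E1's L-free even budgets `NV j m` and the raw budgets `NS j k` of the states -/
  NV : ℕ → ℕ → ℝ
  NS : ℕ → ℕ → ℝ
  /-- the frame-mismatch rates (scale `j`, coarse volume `L`) -/
  sE : ℕ → ℕ → ℝ
  cR : ℕ → ℕ → ℝ
  cC : ℕ → ℕ → ℝ
  δ : ℕ → ℕ → ℝ
  /-- (H1) signs -/
  hΛ : ∀ j, 0 < Λ j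
  hΛmono : ∀ j, Λ (j + 1) ≤ Λ j
  hΛT : ∀ j, Λ j ≤ ΛT j
  hκ : ∀ j, 0 < κ j ∧ 0 < κ' j ∧ 0 < κf j
  haW : ∀ j, 0 ≤ aW j ∧ 0 ≤ aW' j ∧ 0 ≤ sW j ∧ 0 ≤ sW' j ∧ 0 ≤ eW' j ∧ 0 ≤ cW j ∧ 0 ≤ δb j
  hρ : ∀ j, 0 < ρ₀ j ∧ 0 < ρf j ∧ 0 < ρ₂ j ∧ 0 < ρ' j ∧ 0 < ρ₃ j
  hNV0 : ∀ j m, 0 ≤ NV j m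
  hNSnn : ∀ j k, 0 ≤ NS j k
  /-- (H2) the raw-budget recursion -/
  hNS0 : ∀ k, NS 0 k = if Even k then NV 0 (k / 2) else 0
  hNSsucc : ∀ j k, j < nScales β → NS (j + 1) k = (ρ₀ j)⁻¹ ^ k * (Real.exp 1 * ν₀ j) / (1 - Real.exp 1 * aW j * ν₀ j / κ j ^ 2)
  /-- (H3) volume-free smallness of every step -/
  hsm : ∀ j, j < nScales β → TowerScaleSmall (κ j) (κ' j) (aW j) (aW' j) (cW j) (κf j) (cRb j) (cCb j) (δb j) (ρ₀ j) (ρf j) (ρ₂ j) (ρ' j) (ρ₃ j) (NV j) (NS j)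
    (ν₀ j) (ν₁ j) (ν₂ j) (ν₃ j) (ν₄ j) (ν₅ j) (νE j) (ν₆ j) (ν₇ j) (ν₈ j)
  /-- (H4) the mismatch rates: signs, caps, limits -/
  hmis : ∀ j L, 0 ≤ sE j L ∧ 0 ≤ cR j L ∧ 0 ≤ cC j L ∧ 0 ≤ δ j L ∧ cR j L ≤ cRb j ∧ cC j L ≤ cCb j ∧ δ j L ≤ δb j
  hmis0 : ∀ j, Tendsto (sE j) atTop (𝓝 0) ∧ Tendsto (cR j) atTop (𝓝 0) ∧ Tendsto (cC j) atTop (𝓝 0) ∧ Tendsto (δ j) atTop (𝓝 0)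
  /-- (H5) the three data bundles (one-volume bundles SOURCE-TRUNCATED), eventually in `L`, at every admissible instance, at the flow frames -/
  hdata : ∀ᶠ L in atTop, ∀ (b M : ℕ) [NeZero L] [NeZero (b * L)] [NeZero M], Mth L b ≤ M →
    TowerVolumeDataT L M β U μ (klFlowFrameU L M β U μ (nScales β + 1)) (nScales β) (imagTimeWeight β M) Λ κ aW sW NV ∧
      TowerVolumeDataT (b * L) M β U μ (klFlowFrameU (b * L) M β U μ (nScales β + 1)) (nScales β) (imagTimeWeight β M) Λ κ aW sW NV ∧
        TowerCrossData L b M β μ (klFlowFrameU L M β U μ (nScales β + 1)) (klFlowFrameU (b * L) M β U μ (nScales β + 1)) (nScales β) (imagTimeWeight β M)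
          Λ κ' aW' sW' eW' ΛT cW κf (fun j => sE j L) (fun j => cR j L) (fun j => cC j L) (fun j => δ j L)
  /-- (H6) the BASE: the keyed defect of the SOURCE-TRUNCATED step-`0` states at the `2 r_L`-deep pins tends to zero uniformly in the instance -/
  h0 : ∀ (k : ℕ) (η : ℝ), 0 < η → ∀ᶠ L in atTop, ∀ (b M : ℕ) [NeZero L] [NeZero (b * L)] [NeZero M], Mth L b ≤ M →
    ∀ (p : Fin k) (w : SrcLabel (b * L) M 0), (∀ i, 2 * r L ≤ (w.1.1.2 i).val % L ∧ (w.1.1.2 i).val % L + 2 * r L < L) →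
      klKeyedDefectT L b M β U μ (klFlowFrameU L M β U μ (nScales β + 1)) (klFlowFrameU (b * L) M β U μ (nScales β + 1)) 0 k p w ≤ imagTimeWeight β M * η

/-- **The untruncated package yields the truncated one** (the landed v9b chain is the special case). [folklore] -/
def TowerData.trunc {β U μ : ℝ} (D : TowerData β U μ) : TowerDataT β U μ where
  Mth := D.Mth
  r := D.r
  hr := D.hr
  hRd := D.hRd
  Λ := D.Λ
  κ := D.κ
  aW := D.aW
  sW := D.sW
  κ' := D.κ'
  aW' := D.aW'
  sW' := D.sW'
  eW' := D.eW'
  ΛT := D.ΛT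
  cW := D.cW
  κf := D.κf
  cRb := D.cRb
  cCb := D.cCb
  δb := D.δb
  ρ₀ := D.ρ₀
  ρf := D.ρf
  ρ₂ := D.ρ₂
  ρ' := D.ρ'
  ρ₃ := D.ρ₃
  ν₀ := D.ν₀
  ν₁ := D.ν₁
  ν₂ := D.ν₂
  ν₃ := D.ν₃
  ν₄ := D.ν₄
  ν₅ := D.ν₅
  νE := D.νE
  ν₆ := D.ν₆
  ν₇ := D.ν₇
  ν₈ := D.ν₈
  NV := D.NV
  NS := D.NS
  sE := D.sE
  cR := D.cR
  cC := D.cC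
  δ := D.δ
  hΛ := D.hΛ
  hΛmono := D.hΛmono
  hΛT := D.hΛT
  hκ := D.hκ
  haW := D.haW
  hρ := D.hρ
  hNV0 := D.hNV0
  hNSnn := D.hNSnn
  hNS0 := D.hNS0
  hNSsucc := D.hNSsucc
  hsm := D.hsm
  hmis := D.hmis
  hmis0 := D.hmis0
  hdata := by
    filter_upwards [D.hdata] with L hL
    intro b M _ _ _ hM
    obtain ⟨h1, h2, h3⟩ := hL b M hM
    exact ⟨h1.trunc, h2.trunc, h3⟩
  h0 k η hη := by
    filter_upwards [D.h0 k η hη] with L hL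
    intro b M _ _ _ hM p w hw
    exact (klKeyedDefectT_le β U μ _ _ 0 k p w).trans (hL b M hM p w hw)

/-- `Nonempty (TowerData β U μ) → Nonempty (TowerDataT β U μ)`. [folklore] -/
theorem nonempty_towerDataT_of_towerData {β U μ : ℝ} (h : Nonempty (TowerData β U μ)) : Nonempty (TowerDataT β U μ) :=
  h.map TowerData.trunc

end Summit.HubbardSuperconductivity.HubbardSuperconductivity.Theorems.TwoVolumeSource

end
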